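import Mathlib

/-!
# `DivisionGap.PerMultiplesHard` (stmt-ValiantsHypothesis-5068), line `uncharged-face-walk`:
stub `stub_permCounts` — three fibre counts over the symmetric group `Perm (Fin a)`

Statement (`stub_permCounts`, a conjunction of three double-counting identities).
1. For distinct positions `k ≠ k'` and any real weight `g`:
   `Σ_ρ g(ρ k, ρ k') = (a−2)! · Σ_{x ≠ x'} g(x, x')`.
2. The same for four pairwise distinct positions `k₁, k₂, k₃, k₄`:
   `Σ_ρ g(ρ k₁, ρ k₂, ρ k₃, ρ k₄) = (a−4)! · Σ_{(x₁,x₂,x₃,x₄) pairwise distinct} g`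
   (the index set written as nested `erase` sums).
3. For a value set `N` and any family `𝒬` of position sets: the number of `ρ` whose
   preimage set `{k : ρ k ∈ N}` lies in `𝒬` is `#{S ∈ 𝒬 : #S = #N} · (#N)! · (a − #N)!`.

Proof sketch (Mathlib only).
* `card_filter_forall_apply_eq`: the permutations of `Fin a` taking `j` prescribed distinct
  values `y` at `j` distinct points `x` number `(a − j)!`: with `σ ∘ x = y`
  (`Equiv.Perm.exists_smul_eq_embedding`) they form the translate `σ · Stab(x)` of the stabiliser
  of the embedding `x : Fin j ↪ Fin a`, and orbit–stabiliser for the transitive action of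
  `Perm (Fin a)` on `Fin j ↪ Fin a` (`Equiv.Perm.isMultiplyPretransitive`,
  `MulAction.index_stabilizer_of_transitive`, `Subgroup.index_mul_card`,
  `Fintype.card_embedding_eq`, `Nat.factorial_mul_descFactorial`) gives `#Stab(x) = (a − j)!`.
* (1), (2): split `Σ_ρ` along the fibres of `ρ ↦ ρ k₁`, then of `ρ ↦ ρ k₂` (which lands in
  `univ.erase x₁` on the fibre `ρ k₁ = x₁`), and so on (`Finset.sum_fiberwise_of_maps_to`);
  on the innermost fibre the summand is the constant `g x₁ x₂ …` and the fibre has `(a − s)!`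
  elements.
* (3): `S(ρ) := {k : ρ k ∈ N}` always has `#S(ρ) = #N`, and `S(ρ) = S ↔ S.image ρ = N`; the
  number of `σ` with `S.image σ = N` does not depend on the `#S`-set `N` (compose with a
  permutation carrying one such set onto another, `Equiv.extendSubtype`), so it equals
  `a! / C(a, #S) = (#S)! (a − #S)!`; finally sum over `S ∈ 𝒬` with
  `Finset.card_eq_sum_card_fiberwise`.

[folklore]
-/

noncomputable section
set_option linter.dupNamespace false
open Finset
open scoped BigOperators

namespace Summit.ValiantsHypothesis.ValiantsHypothesis.Theorems.DivisionGap.PerMultiplesHard.PermCounts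

/-! ### Permutations with prescribed values at prescribed points -/

/-- For injective `x y : Fin j → Fin a`, the permutations `π` of `Fin a` with `π (x i) = y i` for
all `i` number `(a - j)!`: they form a translate of the stabiliser of the embedding `x` under the
(`j`-transitive) action of `Perm (Fin a)` on `Fin j ↪ Fin a`, and by orbit–stabiliser that
stabiliser has `a! / #(Fin j ↪ Fin a) = a! / (a)_j = (a - j)!` elements. -/
theorem card_filter_forall_apply_eq {a j : ℕ} (x y : Fin j → Fin a)
    (hx : Function.Injective x) (hy : Function.Injective y) :
    (univ.filter fun π : Equiv.Perm (Fin a) => ∀ i, π (x i) = y i).card = (a - j).factorial := by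
  set X : Fin j ↪ Fin a := ⟨x, hx⟩ with hX
  set Y : Fin j ↪ Fin a := ⟨y, hy⟩ with hY
  obtain ⟨σ, hσ⟩ := Equiv.Perm.exists_smul_eq_embedding X Y
  have hiff : ∀ π : Equiv.Perm (Fin a), (∀ i, π (x i) = y i) ↔ π • X = Y := fun π => by
    simp [hX, hY, DFunLike.ext_iff]
  -- the fibre is the translate `σ · Stab(X)`
  have h1 : (univ.filter fun π : Equiv.Perm (Fin a) => ∀ i, π (x i) = y i).card =
      Nat.card (MulAction.stabilizer (Equiv.Perm (Fin a)) X) := by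
    rw [← Fintype.card_subtype, ← Nat.card_eq_fintype_card]
    refine Nat.card_congr (Equiv.subtypeEquiv (Equiv.mulLeft σ⁻¹) fun π => ?_)
    rw [hiff, MulAction.mem_stabilizer_iff, Equiv.coe_mulLeft, mul_smul, inv_smul_eq_iff, hσ]
  -- orbit–stabiliser for the transitive action on `Fin j ↪ Fin a`
  haveI : MulAction.IsPretransitive (Equiv.Perm (Fin a)) (Fin j ↪ Fin a) :=
    Equiv.Perm.isMultiplyPretransitive (Fin a) j
  have h3 := (MulAction.stabilizer (Equiv.Perm (Fin a)) X).index_mul_card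
  rw [MulAction.index_stabilizer_of_transitive, Nat.card_eq_fintype_card (α := Fin j ↪ Fin a),
    Fintype.card_embedding_eq, Fintype.card_fin, Fintype.card_fin, Nat.card_perm,
    Nat.card_eq_fintype_card (α := Fin a), Fintype.card_fin] at h3
  -- `h3 : (a)_j * #Stab(X) = a!`, and `(a - j)! * (a)_j = a!`
  have hj : j ≤ a := by simpa using Fintype.card_le_of_embedding X
  have h4 := Nat.factorial_mul_descFactorial hj
  have hpos : 0 < a.descFactorial j :=
    Nat.pos_of_ne_zero fun h => absurd (Nat.descFactorial_eq_zero_iff_lt.1 h) (not_lt.2 hj)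
  rw [h1]
  refine Nat.eq_of_mul_eq_mul_left hpos ?_
  rw [h3, ← h4, mul_comm]

/-- Two prescribed values: `#{π | π k = x, π k' = x'} = (a - 2)!` for `k ≠ k'`, `x ≠ x'`
(iterated-filter form). -/
theorem card_filter_two {a : ℕ} {k k' x x' : Fin a} (hk : k ≠ k') (hx : x ≠ x') :
    ((univ.filter fun π : Equiv.Perm (Fin a) => π k = x).filter
        fun π : Equiv.Perm (Fin a) => π k' = x').card = (a - 2).factorial := by
  have h1 : Function.Injective ![k, k'] := by
    intro i j hij
    fin_cases i <;> fin_cases j <;> simp_all [eq_comm]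
  have h2 : Function.Injective ![x, x'] := by
    intro i j hij
    fin_cases i <;> fin_cases j <;> simp_all [eq_comm]
  rw [← card_filter_forall_apply_eq ![k, k'] ![x, x'] h1 h2]
  congr 1
  ext π
  simp [Fin.forall_fin_two]

/-- Four prescribed values: `#{π | π kᵢ = xᵢ (i = 1..4)} = (a - 4)!` for pairwise distinct
positions and pairwise distinct values (iterated-filter form). -/
theorem card_filter_four {a : ℕ} {k₁ k₂ k₃ k₄ x₁ x₂ x₃ x₄ : Fin a}
    (h₁₂ : k₁ ≠ k₂) (h₁₃ : k₁ ≠ k₃) (h₁₄ : k₁ ≠ k₄) (h₂₃ : k₂ ≠ k₃) (h₂₄ : k₂ ≠ k₄)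
    (h₃₄ : k₃ ≠ k₄) (g₁₂ : x₁ ≠ x₂) (g₁₃ : x₁ ≠ x₃) (g₁₄ : x₁ ≠ x₄) (g₂₃ : x₂ ≠ x₃)
    (g₂₄ : x₂ ≠ x₄) (g₃₄ : x₃ ≠ x₄) :
    ((((univ.filter fun π : Equiv.Perm (Fin a) => π k₁ = x₁).filter
        fun π : Equiv.Perm (Fin a) => π k₂ = x₂).filter
        fun π : Equiv.Perm (Fin a) => π k₃ = x₃).filter
        fun π : Equiv.Perm (Fin a) => π k₄ = x₄).card = (a - 4).factorial := by
  have h1 : Function.Injective ![k₁, k₂, k₃, k₄] := by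
    intro i j hij
    fin_cases i <;> fin_cases j <;> simp_all [eq_comm]
  have h2 : Function.Injective ![x₁, x₂, x₃, x₄] := by
    intro i j hij
    fin_cases i <;> fin_cases j <;> simp_all [eq_comm]
  rw [← card_filter_forall_apply_eq ![k₁, k₂, k₃, k₄] ![x₁, x₂, x₃, x₄] h1 h2]
  congr 1
  ext π
  simp [Fin.forall_fin_succ, and_assoc]

/-! ### Parts (1) and (2): sums over the symmetric group through `2` and `4` positions -/

/-- **Part (1).** For distinct positions `k ≠ k'`:
`Σ_ρ g(ρ k, ρ k') = (a−2)! · Σ_x Σ_{x' ≠ x} g(x, x')`. -/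
theorem sum_perm_pair (a : ℕ) (k k' : Fin a) (hkk' : k ≠ k') (g : Fin a → Fin a → ℝ) :
    ∑ ρ : Equiv.Perm (Fin a), g (ρ k) (ρ k') =
      ((a - 2).factorial : ℝ) * ∑ x : Fin a, ∑ x' ∈ Finset.univ.erase x, g x x' := by
  rw [← sum_fiberwise_of_maps_to (s := (univ : Finset (Equiv.Perm (Fin a)))) (t := univ)
    (g := fun ρ : Equiv.Perm (Fin a) => ρ k) (fun _ _ => mem_univ _)
    (fun ρ : Equiv.Perm (Fin a) => g (ρ k) (ρ k')), mul_sum]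
  refine sum_congr rfl fun x _ => ?_
  rw [← sum_fiberwise_of_maps_to (s := univ.filter fun ρ : Equiv.Perm (Fin a) => ρ k = x)
    (t := univ.erase x) (g := fun ρ : Equiv.Perm (Fin a) => ρ k') ?_
    (fun ρ : Equiv.Perm (Fin a) => g (ρ k) (ρ k')), mul_sum]
  · refine sum_congr rfl fun x' hx' => ?_
    have hxx' : x ≠ x' := (mem_erase.1 hx').1.symm
    rw [sum_congr rfl (g := fun _ => g x x') fun ρ hρ => by
      simp only [mem_filter, mem_univ, true_and] at hρ
      rw [hρ.1, hρ.2], sum_const, nsmul_eq_mul, card_filter_two hkk' hxx']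
  · intro ρ hρ
    simp only [mem_filter, mem_univ, true_and] at hρ
    subst hρ
    simp [hkk'.symm]

/-- **Part (2).** For pairwise distinct positions `k₁, k₂, k₃, k₄`:
`Σ_ρ g(ρ k₁, ρ k₂, ρ k₃, ρ k₄) = (a−4)! · Σ_{(x₁,x₂,x₃,x₄) pairwise distinct} g`. -/
theorem sum_perm_quad (a : ℕ) (k₁ k₂ k₃ k₄ : Fin a) (h₁₂ : k₁ ≠ k₂) (h₁₃ : k₁ ≠ k₃)
    (h₁₄ : k₁ ≠ k₄) (h₂₃ : k₂ ≠ k₃) (h₂₄ : k₂ ≠ k₄) (h₃₄ : k₃ ≠ k₄)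
    (g : Fin a → Fin a → Fin a → Fin a → ℝ) :
    ∑ ρ : Equiv.Perm (Fin a), g (ρ k₁) (ρ k₂) (ρ k₃) (ρ k₄) =
      ((a - 4).factorial : ℝ) * ∑ x₁ : Fin a, ∑ x₂ ∈ Finset.univ.erase x₁,
        ∑ x₃ ∈ (Finset.univ.erase x₁).erase x₂,
          ∑ x₄ ∈ ((Finset.univ.erase x₁).erase x₂).erase x₃, g x₁ x₂ x₃ x₄ := by
  -- fibres of `ρ ↦ ρ k₁`
  rw [← sum_fiberwise_of_maps_to (s := (univ : Finset (Equiv.Perm (Fin a)))) (t := univ)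
    (g := fun ρ : Equiv.Perm (Fin a) => ρ k₁) (fun _ _ => mem_univ _)
    (fun ρ : Equiv.Perm (Fin a) => g (ρ k₁) (ρ k₂) (ρ k₃) (ρ k₄)), mul_sum]
  refine sum_congr rfl fun x₁ _ => ?_
  -- fibres of `ρ ↦ ρ k₂`
  rw [← sum_fiberwise_of_maps_to (s := univ.filter fun ρ : Equiv.Perm (Fin a) => ρ k₁ = x₁)
    (t := univ.erase x₁) (g := fun ρ : Equiv.Perm (Fin a) => ρ k₂) ?_
    (fun ρ : Equiv.Perm (Fin a) => g (ρ k₁) (ρ k₂) (ρ k₃) (ρ k₄)), mul_sum]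
  swap
  · intro ρ hρ
    simp only [mem_filter, mem_univ, true_and] at hρ
    subst hρ
    simp [h₁₂.symm]
  refine sum_congr rfl fun x₂ hx₂ => ?_
  have g₁₂ : x₁ ≠ x₂ := (mem_erase.1 hx₂).1.symm
  -- fibres of `ρ ↦ ρ k₃`
  rw [← sum_fiberwise_of_maps_to
    (s := (univ.filter fun ρ : Equiv.Perm (Fin a) => ρ k₁ = x₁).filter
      fun ρ : Equiv.Perm (Fin a) => ρ k₂ = x₂)
    (t := (univ.erase x₁).erase x₂) (g := fun ρ : Equiv.Perm (Fin a) => ρ k₃) ?_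
    (fun ρ : Equiv.Perm (Fin a) => g (ρ k₁) (ρ k₂) (ρ k₃) (ρ k₄)), mul_sum]
  swap
  · intro ρ hρ
    simp only [mem_filter, mem_univ, true_and] at hρ
    obtain ⟨e₁, e₂⟩ := hρ
    subst e₁ e₂
    simp [h₁₃.symm, h₂₃.symm]
  refine sum_congr rfl fun x₃ hx₃ => ?_
  have g₂₃ : x₂ ≠ x₃ := (mem_erase.1 hx₃).1.symm
  have g₁₃ : x₁ ≠ x₃ := (mem_erase.1 (mem_erase.1 hx₃).2).1.symm
  -- fibres of `ρ ↦ ρ k₄`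
  rw [← sum_fiberwise_of_maps_to
    (s := ((univ.filter fun ρ : Equiv.Perm (Fin a) => ρ k₁ = x₁).filter
      fun ρ : Equiv.Perm (Fin a) => ρ k₂ = x₂).filter fun ρ : Equiv.Perm (Fin a) => ρ k₃ = x₃)
    (t := ((univ.erase x₁).erase x₂).erase x₃) (g := fun ρ : Equiv.Perm (Fin a) => ρ k₄) ?_
    (fun ρ : Equiv.Perm (Fin a) => g (ρ k₁) (ρ k₂) (ρ k₃) (ρ k₄)), mul_sum]
  swap
  · intro ρ hρ
    simp only [mem_filter, mem_univ, true_and] at hρ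
    obtain ⟨⟨e₁, e₂⟩, e₃⟩ := hρ
    subst e₁ e₂ e₃
    simp [h₁₄.symm, h₂₄.symm, h₃₄.symm]
  refine sum_congr rfl fun x₄ hx₄ => ?_
  have g₃₄ : x₃ ≠ x₄ := (mem_erase.1 hx₄).1.symm
  have g₂₄ : x₂ ≠ x₄ := (mem_erase.1 (mem_erase.1 hx₄).2).1.symm
  have g₁₄ : x₁ ≠ x₄ := (mem_erase.1 (mem_erase.1 (mem_erase.1 hx₄).2).2).1.symm
  -- the innermost fibre: constant summand, `(a - 4)!` elements
  rw [sum_congr rfl (g := fun _ => g x₁ x₂ x₃ x₄) fun ρ hρ => by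
    simp only [mem_filter, mem_univ, true_and] at hρ
    rw [hρ.1.1.1, hρ.1.1.2, hρ.1.2, hρ.2], sum_const, nsmul_eq_mul,
    card_filter_four h₁₂ h₁₃ h₁₄ h₂₃ h₂₄ h₃₄ g₁₂ g₁₃ g₁₄ g₂₃ g₂₄ g₃₄]

/-! ### Part (3): permutations with prescribed preimage set of a value set -/

-- adapted from Literature/Combinatorics/Expanders/BoundedConcentrator.lean
/-- The number of permutations `σ` with `σ(A) = C` does not depend on the `#A`-set `C`
(compose with a permutation carrying `C` onto `C'`). -/
theorem card_perm_image_eq {X : Type*} [Fintype X] [DecidableEq X] (A C C' : Finset X)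
    (hC : C.card = A.card) (hC' : C'.card = A.card) :
    (univ.filter fun σ : Equiv.Perm X => A.image σ = C).card =
      (univ.filter fun σ : Equiv.Perm X => A.image σ = C').card := by
  classical
  have hcard : Fintype.card {x // x ∈ C} = Fintype.card {x // x ∈ C'} := by simp [hC, hC']
  let e : {x // x ∈ C} ≃ {x // x ∈ C'} := Fintype.equivOfCardEq hcard
  let τ : Equiv.Perm X := e.extendSubtype
  have hτ : C.image τ = C' := by
    apply eq_of_subset_of_card_le
    · intro y hy
      obtain ⟨x, hx, rfl⟩ := mem_image.1 hy
      exact e.extendSubtype_mem x hx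
    · rw [card_image_of_injective _ τ.injective, hC, hC']
  refine card_equiv (Equiv.mulLeft τ) fun σ => ?_
  simp only [mem_filter, mem_univ, true_and, Equiv.coe_mulLeft, Equiv.Perm.coe_mul, ← image_image]
  constructor
  · intro h
    rw [h, hτ]
  · intro h
    rw [← hτ] at h
    exact image_injective τ.injective h

-- adapted from Literature/Combinatorics/Expanders/BoundedConcentrator.lean
/-- `#{σ | σ(A) = C} · C(N, #A) = N!` for every `#A`-set `C` (`N = card X`): the `C(N, #A)`
fibres of `σ ↦ σ(A)` have equal size. -/
theorem card_perm_image_mul_choose {X : Type*} [Fintype X] [DecidableEq X] (A C : Finset X)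
    (hC : C.card = A.card) :
    (univ.filter fun σ : Equiv.Perm X => A.image σ = C).card * (Fintype.card X).choose A.card =
      (Fintype.card X).factorial := by
  classical
  have hmaps : ((univ : Finset (Equiv.Perm X)) : Set (Equiv.Perm X)).MapsTo
      (fun σ : Equiv.Perm X => A.image σ) (powersetCard A.card (univ : Finset X)) := by
    intro σ _
    rw [mem_coe, mem_powersetCard]
    exact ⟨subset_univ _, card_image_of_injective _ σ.injective⟩
  have hsum := card_eq_sum_card_fiberwise hmaps
  rw [card_univ, Fintype.card_perm] at hsum
  rw [hsum, sum_congr rfl fun C' hC' => card_perm_image_eq A C' C (mem_powersetCard.1 hC').2 hC,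
    sum_const, card_powersetCard, card_univ, smul_eq_mul, mul_comm]

/-- `#{σ : Perm (Fin a) | σ(S) = N} = (#S)! · (a − #S)!` whenever `#N = #S`. -/
theorem card_perm_image_eq_factorial {a : ℕ} (S N : Finset (Fin a)) (h : N.card = S.card) :
    (univ.filter fun σ : Equiv.Perm (Fin a) => S.image σ = N).card =
      S.card.factorial * (a - S.card).factorial := by
  have h1 := card_perm_image_mul_choose S N h
  rw [Fintype.card_fin] at h1
  have hS : S.card ≤ a := by simpa using S.card_le_univ
  have h2 := Nat.choose_mul_factorial_mul_factorial hS
  refine Nat.eq_of_mul_eq_mul_right (Nat.choose_pos hS) ?_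
  rw [h1, ← h2]
  ring

/-- The preimage set `{k : ρ k ∈ N}` equals `S` iff `ρ` maps `S` onto `N`. -/
theorem filter_apply_mem_eq_iff {a : ℕ} (N S : Finset (Fin a)) (ρ : Equiv.Perm (Fin a)) :
    (univ.filter fun k : Fin a => ρ k ∈ N) = S ↔ S.image ρ = N := by
  constructor
  · intro h
    rw [← h]
    ext y
    simp only [mem_image, mem_filter, mem_univ, true_and]
    constructor
    · rintro ⟨k, hk, rfl⟩
      exact hk
    · intro hy
      exact ⟨ρ.symm y, by simpa using hy, by simp⟩
  · intro h
    rw [← h]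
    ext k
    simp [ρ.injective.mem_finset_image]

/-- The preimage set `{k : ρ k ∈ N}` of a permutation `ρ` has exactly `#N` elements. -/
theorem card_filter_apply_mem {a : ℕ} (N : Finset (Fin a)) (ρ : Equiv.Perm (Fin a)) :
    (univ.filter fun k : Fin a => ρ k ∈ N).card = N.card := by
  have h := (filter_apply_mem_eq_iff N _ ρ).1 rfl
  calc (univ.filter fun k : Fin a => ρ k ∈ N).card
      = ((univ.filter fun k : Fin a => ρ k ∈ N).image ρ).card :=
        (card_image_of_injective _ ρ.injective).symm
    _ = N.card := by rw [h]

/-- **Part (3).** For a value set `N` and a family `𝒬` of position sets, the permutations `ρ`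
with `{k : ρ k ∈ N} ∈ 𝒬` number `#{S ∈ 𝒬 : #S = #N} · (#N)! · (a − #N)!`. -/
theorem card_filter_preimage_mem (a : ℕ) (N : Finset (Fin a)) (𝒬 : Finset (Finset (Fin a))) :
    ((Finset.univ : Finset (Equiv.Perm (Fin a))).filter
        (fun ρ => (Finset.univ.filter fun k : Fin a => ρ k ∈ N) ∈ 𝒬)).card =
      (𝒬.filter fun S => S.card = N.card).card * N.card.factorial * (a - N.card).factorial := by
  have hmaps : (((Finset.univ : Finset (Equiv.Perm (Fin a))).filter
      (fun ρ => (Finset.univ.filter fun k : Fin a => ρ k ∈ N) ∈ 𝒬) : Finset _) : Set _).MapsTo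
      (fun ρ : Equiv.Perm (Fin a) => Finset.univ.filter fun k : Fin a => ρ k ∈ N)
      (𝒬.filter fun S => S.card = N.card) := by
    intro ρ hρ
    rw [mem_coe, mem_filter] at hρ
    rw [mem_coe, mem_filter]
    exact ⟨hρ.2, card_filter_apply_mem N ρ⟩
  rw [card_eq_sum_card_fiberwise hmaps]
  have hfib : ∀ S ∈ 𝒬.filter (fun S => S.card = N.card),
      (((Finset.univ : Finset (Equiv.Perm (Fin a))).filter
          (fun ρ => (Finset.univ.filter fun k : Fin a => ρ k ∈ N) ∈ 𝒬)).filter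
        (fun ρ => (Finset.univ.filter fun k : Fin a => ρ k ∈ N) = S)).card =
        N.card.factorial * (a - N.card).factorial := by
    intro S hS
    obtain ⟨hS𝒬, hSc⟩ := mem_filter.1 hS
    have hset : (((Finset.univ : Finset (Equiv.Perm (Fin a))).filter
          (fun ρ => (Finset.univ.filter fun k : Fin a => ρ k ∈ N) ∈ 𝒬)).filter
        (fun ρ => (Finset.univ.filter fun k : Fin a => ρ k ∈ N) = S)) =
        univ.filter fun σ : Equiv.Perm (Fin a) => S.image σ = N := by
      ext ρ
      simp only [mem_filter, mem_univ, true_and]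
      rw [← filter_apply_mem_eq_iff N S ρ]
      constructor
      · exact fun hρ => hρ.2
      · intro hρ
        refine ⟨?_, hρ⟩
        rw [hρ]
        exact hS𝒬
    rw [hset, card_perm_image_eq_factorial S N hSc.symm, hSc]
  rw [sum_congr rfl hfib, sum_const, smul_eq_mul]
  ring

/-! ### The registered stub -/

/-- **`stub_permCounts`** — three fibre counts over the symmetric group `Perm (Fin a)`:
(1) `Σ_ρ g(ρ k, ρ k') = (a−2)! · Σ_{x ≠ x'} g(x, x')` for `k ≠ k'`;
(2) `Σ_ρ g(ρ k₁, ρ k₂, ρ k₃, ρ k₄) = (a−4)! · Σ_{pairwise distinct} g` for pairwise distinct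
positions; (3) `#{ρ : {k : ρ k ∈ N} ∈ 𝒬} = #{S ∈ 𝒬 : #S = #N} · (#N)! · (a − #N)!`. -/
theorem stub_permCounts :
    (∀ (a : ℕ) (k k' : Fin a), k ≠ k' → ∀ g : Fin a → Fin a → ℝ,
      ∑ ρ : Equiv.Perm (Fin a), g (ρ k) (ρ k') =
        ((a - 2).factorial : ℝ) * ∑ x : Fin a, ∑ x' ∈ Finset.univ.erase x, g x x') ∧
    (∀ (a : ℕ) (k₁ k₂ k₃ k₄ : Fin a), k₁ ≠ k₂ → k₁ ≠ k₃ → k₁ ≠ k₄ → k₂ ≠ k₃ → k₂ ≠ k₄ → k₃ ≠ k₄ →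
      ∀ g : Fin a → Fin a → Fin a → Fin a → ℝ,
      ∑ ρ : Equiv.Perm (Fin a), g (ρ k₁) (ρ k₂) (ρ k₃) (ρ k₄) =
        ((a - 4).factorial : ℝ) * ∑ x₁ : Fin a, ∑ x₂ ∈ Finset.univ.erase x₁, ∑ x₃ ∈ (Finset.univ.erase x₁).erase x₂,
          ∑ x₄ ∈ ((Finset.univ.erase x₁).erase x₂).erase x₃, g x₁ x₂ x₃ x₄) ∧
    (∀ (a : ℕ) (N : Finset (Fin a)) (𝒬 : Finset (Finset (Fin a))),
      ((Finset.univ : Finset (Equiv.Perm (Fin a))).filter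
          (fun ρ => (Finset.univ.filter fun k : Fin a => ρ k ∈ N) ∈ 𝒬)).card =
        (𝒬.filter fun S => S.card = N.card).card * N.card.factorial * (a - N.card).factorial) :=
  ⟨sum_perm_pair, sum_perm_quad, card_filter_preimage_mem⟩

end Summit.ValiantsHypothesis.ValiantsHypothesis.Theorems.DivisionGap.PerMultiplesHard.PermCounts
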